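import Literature.MathematicalPhysics.QuantumFieldTheory.Balaban1983to89.B1Eq324BenfattoAppendixC2
import Literature.MathematicalPhysics.QuantumFieldTheory.Balaban1983to89.B1Eq324BenfattoAppendixCLemma2
import HarnessLib

/-!
# `Balaban1983to89.B1Eq324BenfattoMarkov` — [BenfattoEtAl1978] «the Markov property of P» (§5 (5.13) p. 155) and the
# Dirichlet-covariance structure of Appendix C 2) ((C.6)–(C.7) p. 164), PROVED for the tree's free field `freeCov` and
# conditioned field `condMean` / `condCov` (`B1Eq324BenfattoLemma`, p463705); plus the walk-series decay (C.3)–(C.5) for r15's `Cxi`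

statement-level skeleton of published theorems with citation tags; proofs where landed; nothing here is a claim about the
Yang–Mills mass gap

WHY THIS MODULE (cell `pub-ymgap`, seat `dag-n08-d` gen 8; node N08 [Balaban1985UV3] — in-edge SOURCE chain behind the (α)-schema
row `h324c`: [B10] (24)/(58) ← [B1] (3.24) ← [BenfattoEtAl1978] Lemma p. 152 = `B1Eq324BenfattoLemma.BasicLemmaPrinted`).  §5 of
[BenfattoEtAl1978] proves that lemma by conditioning the free field (1.1) on corridors `Γ₁` and using, at (5.13) p. 155, *"P(dz_□̃|z_{Γ₁})
is their conditional probability for fixed z_{Γ₁} and the Markov property of P has been used"* (the conditioned measure factorizes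
over the boxes the corridors enclose), and, at (5.23)–(5.30), the structure of the conditioned field recorded in Appendix C 2) p. 164:
*"the conditioned variables (z_Δ)_{Δ∉Γ} are a non centered gaussian field with covariance C^Γ_{ΔΔ′} such that 0 ≦ C^Γ_{ΔΔ′} ≦ C_{ΔΔ′}
(C.6) and center u_Δ = β Σ_{Δ′⊂Γ} (Σ_{Δ″⊄Γ, Δ″ n.n. to Δ′} C^Γ_{ΔΔ″}) z_Δ′ (C.7). C^Γ_{Δ,Δ′} is the covariance with “Dirichelet boundary
condition” on Γ. … The above properties are well-known [7]."*  The tree's conditioned field is DEFINED by Gaussian regression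
(`condMean`, `condCov` = Schur complement); this file proves that those regression objects HAVE the printed Markov/Dirichlet structure.
Companion files of seat n08-b: `…CondCentre` ((C.8), lattice equation, harmonicity of the centre), `…AppendixC2` ((C.2)/(C.4)/(C.5),
STRICT positive definiteness `posDef_covGram_freeCov`, (C.6) entrywise `condCov_freeCov_nonneg_le`), `…AppendixC`/`…AppendixCLemma2`
(Lemmata 1–2), `…AppendixA`.

WHAT IS PROVED (no definition, no named fact, no `sorry`; axioms standard).  `K = freeCov d α β`, `C^Γ = condCov K Γ`, `u = condMean K Γ z̄`,
`H` = the nearest-neighbour sum `B3CxiPropagator.hop`, `α, β > 0` throughout.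
* §0 (private) linearity of `H`; `freeCov_hop_eq` — n08-b's lattice equation `(2d + α²)K(x,y) − (HK(·,y))(x) = β⁻¹[x = y]` in `H`-form.
* §1 ★ `Cxi_le_geom_pow_l1` — (C.3)–(C.5) BY THE WALK ROUTE for r15's unit propagator: `C^ξ(y) ≤ ξ^{−d}·(2d/(2d + ξ²))^{|y|₁}` from the
  Neumann series `B3CxiPropagator.Cxi_eq_neumannK` (= print's (C.3) «π_n(Δ, Δ′) the number of walks … divided by (2d)ⁿ»): walks shorter
  than `|y|₁` miss `y`, the rest is a geometric tail.  (n08-b's `freeCov_le_self_mul_pow_l1`/`freeCov_le_decay` give the decay of `K` by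
  the maximum principle; this is the independent walk-series statement for `Cxi`.)
* §2 consequences of n08-b's strict positivity: `condMean_freeCov_apply_of_mem` (`u = z̄` on `Γ`, hypothesis-free), `condCov_of_mem_left` /
  `condCov_of_mem_right` / `condCov_freeCov_of_mem` (`C^Γ(c,·) = C^Γ(·,c) = 0` on `Γ`: conditioned coordinates are deterministic),
  `condCov_comm` (symmetric kernel ⇒ `C^Γ` symmetric).
* §3 ★ `condCov_freeCov_lattice_eq` — off `Γ`, `(2d + α²)C^Γ(x,y) − (HC^Γ(·,y))(x) = β⁻¹[x = y]` (the Dirichlet Green's-function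
  equation); `abs_condCov_freeCov_le` (`|C^Γ| ≤ (βα²)⁻¹`); private a-priori bounds.
* §4 the massive maximum principle on `ℤ^d ∖ Γ` in sup form for BOUNDED sub/solutions (`m > 2d`): `le_of_hop_subsolution`,
  `eq_zero_of_hop_solution` — the one engine of §5 (no finiteness of regions, no maximisers); public as the citable copy (n08-b's request).
* §5 ★★ `condCov_freeCov_eq_zero_of_enclosed` (+ `…'`) — THE MARKOV PROPERTY: if `Ω ⊆ ℤ^d ∖ Γ` is ENCLOSED by `Γ` (every lattice
  neighbour of a site of `Ω` lies in `Ω ∪ Γ`; `Ω` may be infinite) then `C^Γ(x, y) = 0 = C^Γ(y, x)` for `x ∈ Ω`, `y ∉ Ω` — given `z_Γ`,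
  the field inside `Ω` is uncorrelated with the field outside;  ★★ `condMean_freeCov_eq_boundary_sum` — (C.7) AS AN IDENTITY: for `x ∉ Γ`,
  `u(x) = β Σ_{c∈Γ} (HC^Γ(x,·))(c)·z̄_c` (print's inner sum over `Δ″ ⊄ Γ` n.n. to `Δ′`; the neighbours inside `Γ` contribute `0` by §2);
  ★ `condMean_freeCov_congr_of_enclosed` — LOCALITY of the centre: on a `Γ`-enclosed `Ω`, `u` depends on `z̄` only at the sites of `Γ`
  adjacent to `Ω`.
* §6 `P̄ = condField d α β Γ z̄` AS A MEASURE (on n08-b's `isPosSemidefKernel_condCov_freeCov`): `isProbabilityMeasure_condField`,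
  ★ `isGaussianProcess_condField` (the coordinates are a Gaussian field under `P̄`), `integral_eval_condField` (centre `u`),
  `covariance_eval_condField` (covariance `C^Γ`) — together print's *"the conditioned variables … are a non centered gaussian field
  with covariance C^Γ_{ΔΔ′} … and center u_Δ"* for the tree's `P̄`; ★★ `indepFun_condField_of_enclosed` — THE MARKOV PROPERTY AS
  INDEPENDENCE: under `P̄`, for a `Γ`-enclosed `Ω`, the families `(z_x)_{x∈Ω}` and `(z_y)_{y∉Ω}` are independent (jointly Gaussian +
  §5, via Mathlib's `IsGaussianProcess.indepFun_of_covariance_eq_zero`), and ★★ `iIndepFun_condField_of_enclosed` — for a family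
  of pairwise disjoint `Γ`-enclosed regions the coordinate families are MUTUALLY independent under `P̄` = the factorisation «over the
  boxes □» used at (5.13).
HONEST SCOPE.  `P̄` is the tree's regression-DEFINED conditioned field; the disintegration of `P0` along `P̄` (that `P̄` IS a regular
conditional distribution of `P0` given `z_Γ`) is NOT proved here (as in p463705's honest scope).  Nearest tree prior art: the
massless, `d ≥ 3` domain Markov property `LatticeModels.DiscreteGFFMarkov` (Dirichlet Green function of a FINITE region, harmonic
extension) — different object (`latticeGreen`, no mass, finite `K`); nothing of it is restated.  Route ≠
print's for (C.6)–(C.7) (print: walk expansion with Dirichlet condition; here: lattice equation + maximum principle).  count-neutral for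
N08; `BasicLemmaPrinted` NOT discharged; nothing about d = 4, the continuum, OS axioms, a mass gap or the Clay problem.
-/

noncomputable section

open Finset Matrix
open scoped BigOperators Matrix

namespace Literature.MathematicalPhysics.QuantumFieldTheory.Balaban1983to89.B1Eq324BenfattoMarkov

open Literature.MathematicalPhysics.QuantumFieldTheory
open Literature.MathematicalPhysics.QuantumFieldTheory.Balaban1983to89.B3Sect3VectorSelfEnergy
open Literature.MathematicalPhysics.QuantumFieldTheory.Balaban1983to89.B3CxiPropagator
open Literature.MathematicalPhysics.QuantumFieldTheory.Balaban1983to89.B3WT226FreeLattice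
open Literature.MathematicalPhysics.QuantumFieldTheory.Balaban1983to89.B1Eq324BenfattoLemma
open Literature.MathematicalPhysics.QuantumFieldTheory.Balaban1983to89.B1Eq324BenfattoCondCentre
open Literature.MathematicalPhysics.QuantumFieldTheory.Balaban1983to89.B1Eq324BenfattoAppendixC2
open Literature.MathematicalPhysics.QuantumFieldTheory.Balaban1983to89.B1Eq324BenfattoAppendixCLemma2

variable {d : ℕ}

/-! ## §0  The hopping sum `(Hf)(x) = Σ_μ (f(x + e_μ) + f(x − e_μ))` — linearity (kernel plumbing) -/

/-- kernel: `H` is additive. [folklore] -/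
private theorem hop_add' (f g : ZSite d → ℝ) (x : ZSite d) :
    hop (fun z => f z + g z) x = hop f x + hop g x := by
  simp only [hop, ← Finset.sum_add_distrib]
  exact Finset.sum_congr rfl fun μ _ => by ring

/-- kernel: `H` commutes with subtraction. [folklore] -/
private theorem hop_sub' (f g : ZSite d → ℝ) (x : ZSite d) :
    hop (fun z => f z - g z) x = hop f x - hop g x := by
  simp only [hop, ← Finset.sum_sub_distrib]
  exact Finset.sum_congr rfl fun μ _ => by ring

/-- kernel: `H` commutes with negation. [folklore] -/
private theorem hop_neg' (f : ZSite d → ℝ) (x : ZSite d) : hop (fun z => -f z) x = -hop f x := by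
  simp only [hop, ← Finset.sum_neg_distrib]
  exact Finset.sum_congr rfl fun μ _ => by ring

/-- kernel: `H` commutes with right scalar multiplication. [folklore] -/
private theorem hop_mul_const' (f : ZSite d → ℝ) (a : ℝ) (x : ZSite d) :
    hop (fun z => f z * a) x = hop f x * a := by
  simp only [hop, Finset.sum_mul]
  exact Finset.sum_congr rfl fun μ _ => by ring

/-- kernel: `H` commutes with left scalar multiplication. [folklore] -/
private theorem hop_const_mul' (a : ℝ) (f : ZSite d → ℝ) (x : ZSite d) :
    hop (fun z => a * f z) x = a * hop f x := by
  simp only [hop, Finset.mul_sum]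
  exact Finset.sum_congr rfl fun μ _ => by ring

/-- kernel: `H` commutes with finite sums. [folklore] -/
private theorem hop_sum_univ' {ι : Type*} [Fintype ι] (f : ι → ZSite d → ℝ) (x : ZSite d) :
    hop (fun z => ∑ i, f i z) x = ∑ i, hop (f i) x := by
  calc hop (fun z => ∑ i, f i z) x = ∑ μ : Fin d, ∑ i, (f i (x + unitVec μ) + f i (x - unitVec μ)) := by
        simp only [hop, Finset.sum_add_distrib]
    _ = ∑ i, hop (f i) x := by
        rw [Finset.sum_comm]
        rfl

/-- kernel: `H` commutes with sums over a finite set. [folklore] -/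
private theorem hop_finset_sum' {ι : Type*} (s : Finset ι) (f : ι → ZSite d → ℝ) (x : ZSite d) :
    hop (fun z => ∑ i ∈ s, f i z) x = ∑ i ∈ s, hop (f i) x := by
  calc hop (fun z => ∑ i ∈ s, f i z) x = ∑ μ : Fin d, ∑ i ∈ s, (f i (x + unitVec μ) + f i (x - unitVec μ)) := by
        simp only [hop, Finset.sum_add_distrib]
    _ = ∑ i ∈ s, hop (f i) x := by
        rw [Finset.sum_comm]
        rfl

/-- kernel: the value of `H` at `x` of a function vanishing at the `2d` neighbours of `x` is `0`. [folklore] -/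
private theorem hop_eq_zero_of_forall (f : ZSite d → ℝ) (x : ZSite d)
    (h : ∀ μ : Fin d, f (x + unitVec μ) = 0 ∧ f (x - unitVec μ) = 0) : hop f x = 0 := by
  simp only [hop]
  exact Finset.sum_eq_zero fun μ _ => by rw [(h μ).1, (h μ).2, add_zero]

/-- kernel: `|Hf(x)| ≤ 2d·M` for `|f| ≤ M`. [folklore] -/
private theorem abs_hop_le' {f : ZSite d → ℝ} {M : ℝ} (hf : ∀ z, |f z| ≤ M) (x : ZSite d) : |hop f x| ≤ 2 * d * M := by
  simp only [hop]
  calc |∑ μ : Fin d, (f (x + unitVec μ) + f (x - unitVec μ))|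
      ≤ ∑ μ : Fin d, |f (x + unitVec μ) + f (x - unitVec μ)| := Finset.abs_sum_le_sum_abs _ _
    _ ≤ ∑ _μ : Fin d, (M + M) := Finset.sum_le_sum fun μ _ => (abs_add_le _ _).trans (add_le_add (hf _) (hf _))
    _ = 2 * d * M := by
        rw [Finset.sum_const, Finset.card_univ, Fintype.card_fin, nsmul_eq_mul]
        ring

/-- **The lattice equation of the free covariance in `H`-form**: `(2d + α²)K(x, y) − (HK(·, y))(x) = β⁻¹·[x = y]`
(n08-b's `freeCov_lattice_eq`). [cite: BenfattoEtAl1978, (1.1) p.144] -/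
theorem freeCov_hop_eq {α : ℝ} (β : ℝ) (hα : 0 < α) (x y : ZSite d) :
    (2 * d + α ^ 2) * freeCov d α β x y - hop (fun z => freeCov d α β z y) x = if x = y then β⁻¹ else 0 :=
  freeCov_lattice_eq β hα x y

/-! ## §1  (C.4)–(C.5): exponential decay of the free covariance, from the walk representation (C.3) -/

section Decay

variable {ξ : ℝ}

/-- kernel: `0 ≤ W_k(y) ≤ (2d)^k`. [folklore] -/
private theorem walkCount_nonneg_and_le : ∀ (k : ℕ) (y : ZSite d), 0 ≤ walkCount k y ∧ walkCount k y ≤ (2 * d : ℝ) ^ k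
  | 0, y => by
      simp only [walkCount, pow_zero]
      split_ifs <;> norm_num
  | k + 1, y => by
      simp only [walkCount, hop, pow_succ]
      refine ⟨Finset.sum_nonneg fun μ _ =>
        add_nonneg (walkCount_nonneg_and_le k _).1 (walkCount_nonneg_and_le k _).1, ?_⟩
      calc ∑ μ : Fin d, (walkCount k (y + unitVec μ) + walkCount k (y - unitVec μ))
          ≤ ∑ _μ : Fin d, ((2 * d : ℝ) ^ k + (2 * d : ℝ) ^ k) :=
            Finset.sum_le_sum fun μ _ => add_le_add (walkCount_nonneg_and_le k _).2 (walkCount_nonneg_and_le k _).2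
        _ = (2 * d : ℝ) ^ k * (2 * d) := by
            rw [Finset.sum_const, Finset.card_univ, Fintype.card_fin, nsmul_eq_mul]
            ring

/-- kernel: `|y|₁ ≤ |y + e_μ|₁ + 1`. [folklore] -/
private theorem l1_le_l1_add_unitVec_add_one (y : ZSite d) (μ : Fin d) : l1 y ≤ l1 (y + unitVec μ) + 1 := by
  have h := l1_add_le (y + unitVec μ) (-unitVec μ)
  rw [add_neg_cancel_right, l1_neg, l1_unitVec] at h
  exact h

/-- kernel: `|y|₁ ≤ |y − e_μ|₁ + 1`. [folklore] -/
private theorem l1_le_l1_sub_unitVec_add_one (y : ZSite d) (μ : Fin d) : l1 y ≤ l1 (y - unitVec μ) + 1 := by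
  have h := l1_add_le (y - unitVec μ) (unitVec μ)
  rw [sub_add_cancel, l1_unitVec] at h
  exact h

/-- kernel: `W_k(y) = 0` for `k < |y|₁` — a nearest-neighbour walk of length `k` from `0` ends at ℓ¹-distance at most `k`.
[folklore] -/
private theorem walkCount_eq_zero_of_lt_l1 : ∀ (k : ℕ) (y : ZSite d), k < l1 y → walkCount k y = 0
  | 0, y, h => by
      simp only [walkCount]
      rw [if_neg]
      rintro rfl
      simp [l1] at h
  | k + 1, y, h => by
      simp only [walkCount, hop]
      refine Finset.sum_eq_zero fun μ _ => ?_
      rw [walkCount_eq_zero_of_lt_l1 k _ (by have := l1_le_l1_add_unitVec_add_one y μ; omega),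
        walkCount_eq_zero_of_lt_l1 k _ (by have := l1_le_l1_sub_unitVec_add_one y μ; omega), add_zero]

/-- kernel: `θ = (2d + ξ²)⁻¹ > 0`, `ρ = 2dθ ∈ [0, 1)` and `1 − ρ = θξ²`. [folklore] -/
private theorem hopWeight_facts (hξ : 0 < ξ) :
    0 < hopWeight d ξ ∧ 0 ≤ 2 * d * hopWeight d ξ ∧ 2 * d * hopWeight d ξ < 1 ∧
      1 - 2 * d * hopWeight d ξ = hopWeight d ξ * ξ ^ 2 := by
  have hpos : 0 < hopWeight d ξ := by unfold hopWeight; positivity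
  have hone : 1 - 2 * d * hopWeight d ξ = hopWeight d ξ * ξ ^ 2 := by
    unfold hopWeight
    have hne : (2 * d + ξ ^ 2 : ℝ) ≠ 0 := by positivity
    field_simp
    ring
  refine ⟨hpos, mul_nonneg (by positivity) hpos.le, ?_, hone⟩
  nlinarith [mul_pos hpos (pow_pos hξ 2)]

/-- kernel: the geometric tail `Σ_{k ≥ n} ρ^k = ρⁿ/(1 − ρ)` written as a series over `ℕ`, with its summability. [folklore] -/
private theorem tail_geometric {ρ : ℝ} (h0 : 0 ≤ ρ) (h1 : ρ < 1) (n : ℕ) :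
    Summable (fun k : ℕ => if k < n then (0 : ℝ) else ρ ^ k) ∧
      ∑' k : ℕ, (if k < n then (0 : ℝ) else ρ ^ k) = ρ ^ n / (1 - ρ) := by
  set g : ℕ → ℝ := fun k => if k < n then 0 else ρ ^ k with hg
  have hgs : Summable g := by
    refine Summable.of_nonneg_of_le (fun k => ?_) (fun k => ?_) (summable_geometric_of_lt_one h0 h1)
    · simp only [hg]
      split_ifs
      exacts [le_rfl, pow_nonneg h0 k]
    · simp only [hg]
      split_ifs
      exacts [pow_nonneg h0 k, le_rfl]
  refine ⟨hgs, ?_⟩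
  rw [← hgs.sum_add_tsum_nat_add n]
  have h1' : ∑ k ∈ Finset.range n, g k = 0 := Finset.sum_eq_zero fun k hk => by
    simp only [hg, if_pos (Finset.mem_range.mp hk)]
  have h2 : (fun k => g (k + n)) = fun k => ρ ^ n * ρ ^ k := by
    funext k
    simp only [hg, if_neg (by omega : ¬ (k + n < n)), pow_add, mul_comm]
  rw [h1', zero_add, h2, tsum_mul_left, tsum_geometric_of_lt_one h0 h1, div_eq_mul_inv]

/-- kernel: the walk series of (C.3) is dominated termwise by the geometric tail starting at `|y|₁`. [folklore] -/
private theorem neumann_term_le_tail (hξ : 0 < ξ) (k : ℕ) (y : ZSite d) :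
    hopWeight d ξ ^ k * walkCount k y ≤ if k < l1 y then 0 else (2 * d * hopWeight d ξ) ^ k := by
  obtain ⟨hθ, -, -, -⟩ := hopWeight_facts (d := d) hξ
  split_ifs with h
  · rw [walkCount_eq_zero_of_lt_l1 k y h, mul_zero]
  · calc hopWeight d ξ ^ k * walkCount k y ≤ hopWeight d ξ ^ k * (2 * d : ℝ) ^ k :=
          mul_le_mul_of_nonneg_left (walkCount_nonneg_and_le k y).2 (pow_nonneg hθ.le k)
      _ = (2 * d * hopWeight d ξ) ^ k := by ring

/-- **(C.4)–(C.5) for the tree's unit-lattice propagator — EXPONENTIAL DECAY FROM THE WALK REPRESENTATION (C.3)**: r15's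
`C^ξ = (−Δ^ξ + 1)⁻¹` equals its random-walk (Neumann) series `θξ²ξ^{−d} Σ_k θ^k W_k` (`B3CxiPropagator.Cxi_eq_neumannK`,
print's (C.3) «π_n(Δ, Δ′) the number of walks … divided by (2d)ⁿ»), the walks shorter than `|y|₁` do not reach `y`, and the
rest is a geometric tail: `C^ξ(y) ≤ ξ^{−d}·(2d/(2d + ξ²))^{|y|₁}` — exponential decay in the lattice distance with rate
`log((2d + ξ²)/2d)`. [cite: BenfattoEtAl1978, Appendix C (C.3)–(C.5) p.164] -/
theorem Cxi_le_geom_pow_l1 (hξ : 0 < ξ) (y : ZSite d) :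
    Cxi d ξ y ≤ ξ⁻¹ ^ d * (2 * d * hopWeight d ξ) ^ l1 y := by
  obtain ⟨hθ, hρ0, hρ1, hone⟩ := hopWeight_facts (d := d) hξ
  obtain ⟨htail, htsum⟩ := tail_geometric hρ0 hρ1 (l1 y)
  rw [Cxi_eq_neumannK hξ, neumannK]
  have hsum : Summable fun k : ℕ => hopWeight d ξ ^ k * walkCount k y :=
    Summable.of_nonneg_of_le (fun k => mul_nonneg (pow_nonneg hθ.le k) (walkCount_nonneg_and_le k y).1)
      (fun k => (neumann_term_le_tail hξ k y).trans (by
        split_ifs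
        exacts [pow_nonneg hρ0 k, le_rfl]))
      (summable_geometric_of_lt_one hρ0 hρ1)
  have hle : ∑' k, hopWeight d ξ ^ k * walkCount k y ≤ (2 * d * hopWeight d ξ) ^ l1 y / (1 - 2 * d * hopWeight d ξ) := by
    rw [← htsum]
    exact hsum.tsum_le_tsum (fun k => neumann_term_le_tail hξ k y) htail
  rw [hone] at hle
  have hξd : 0 ≤ ξ⁻¹ ^ d := pow_nonneg (inv_nonneg.mpr hξ.le) d
  calc hopWeight d ξ * ξ ^ 2 * ξ⁻¹ ^ d * ∑' k, hopWeight d ξ ^ k * walkCount k y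
      ≤ hopWeight d ξ * ξ ^ 2 * ξ⁻¹ ^ d * ((2 * d * hopWeight d ξ) ^ l1 y / (hopWeight d ξ * ξ ^ 2)) :=
        mul_le_mul_of_nonneg_left hle (by positivity)
    _ = ξ⁻¹ ^ d * (2 * d * hopWeight d ξ) ^ l1 y := by
        have hne : hopWeight d ξ * ξ ^ 2 ≠ 0 := by positivity
        field_simp

end Decay

/-! ## §2  Consequences of strict positivity (n08-b's `posDef_covGram_freeCov`): the conditioned field ON Γ -/

section StrictPD

variable {α β : ℝ}

/-- **On Γ the conditional centre IS the conditioning datum**, hypothesis-free for the free field: `u(c) = z̄_c`, `c ∈ Γ`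
(n08-b's `condMean_apply_of_mem` with its invertibility hypothesis discharged by `isUnit_det_covGram_freeCov`).
[cite: BenfattoEtAl1978, Appendix C 2) (C.7) p.164] -/
theorem condMean_freeCov_apply_of_mem (hα : 0 < α) (hβ : 0 < β) (Γ : Finset (ZSite d)) (zbar : ZSite d → ℝ)
    {c : ZSite d} (hc : c ∈ Γ) : condMean (freeCov d α β) Γ zbar c = zbar c :=
  condMean_apply_of_mem _ Γ zbar (isUnit_det_covGram_freeCov hα hβ Γ) hc

/-- **The conditioned covariance vanishes on the conditioning region (first argument)**: for an invertible Gram matrix,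
`C^Γ(c, y) = 0` for `c ∈ Γ` (`K_ΓΓ(K_ΓΓ)⁻¹ = 1`) — the conditioned variables `z_c`, `c ∈ Γ`, are deterministic.
[cite: BenfattoEtAl1978, Appendix C 2) (C.6) p.164] -/
theorem condCov_of_mem_left {G : ZSite d → ZSite d → ℝ} (Γ : Finset (ZSite d)) (hdet : IsUnit (covGram G Γ).det)
    {c : ZSite d} (hc : c ∈ Γ) (y : ZSite d) : condCov G Γ c y = 0 := by
  rw [condCov, sub_eq_zero]
  have h : ∑ c₁ : Γ, ∑ c₂ : Γ, G c c₁ * (covGram G Γ)⁻¹ c₁ c₂ * G c₂ y =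
      ∑ c₂ : Γ, (covGram G Γ * (covGram G Γ)⁻¹) ⟨c, hc⟩ c₂ * G c₂ y := by
    rw [Finset.sum_comm]
    refine Finset.sum_congr rfl fun c₂ _ => ?_
    rw [Matrix.mul_apply, Finset.sum_mul]
    exact Finset.sum_congr rfl fun c₁ _ => by rw [covGram_apply]
  rw [h, Matrix.mul_nonsing_inv _ hdet]
  simp only [Matrix.one_apply, ite_mul, one_mul, zero_mul, Finset.sum_ite_eq, Finset.mem_univ, if_true]

/-- **The conditioned covariance is symmetric** for a symmetric kernel (the inverse of the symmetric Gram matrix is symmetric).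
[cite: BenfattoEtAl1978, Appendix C 2) (C.6) p.164] -/
theorem condCov_comm {G : ZSite d → ZSite d → ℝ} (hG : ∀ x y, G x y = G y x) (Γ : Finset (ZSite d)) (x y : ZSite d) :
    condCov G Γ x y = condCov G Γ y x := by
  have ht : (covGram G Γ)ᵀ = covGram G Γ := by
    ext i j
    simp only [Matrix.transpose_apply, covGram_apply, hG]
  have hsym : ∀ a b : Γ, (covGram G Γ)⁻¹ a b = (covGram G Γ)⁻¹ b a := by
    intro a b
    have h := Matrix.transpose_nonsing_inv (covGram G Γ)
    rw [ht] at h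
    have h2 := congrFun (congrFun h b) a
    rwa [Matrix.transpose_apply] at h2
  simp only [condCov]
  rw [hG x y]
  congr 1
  conv_rhs => rw [Finset.sum_comm]
  refine Finset.sum_congr rfl fun a _ => Finset.sum_congr rfl fun b _ => ?_
  rw [hG x a, hG b y, hsym b a]
  ring

/-- `C^Γ(x, c) = 0` for `c ∈ Γ` (second argument; symmetric kernel, invertible Gram matrix).
[cite: BenfattoEtAl1978, Appendix C 2) (C.6) p.164] -/
theorem condCov_of_mem_right {G : ZSite d → ZSite d → ℝ} (hG : ∀ x y, G x y = G y x) (Γ : Finset (ZSite d))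
    (hdet : IsUnit (covGram G Γ).det) (x : ZSite d) {c : ZSite d} (hc : c ∈ Γ) : condCov G Γ x c = 0 := by
  rw [condCov_comm hG, condCov_of_mem_left Γ hdet hc]

/-- `C^Γ(c, y) = 0 = C^Γ(y, c)` for the FREE field, `c ∈ Γ`, hypothesis-free. [cite: BenfattoEtAl1978, Appendix C 2) (C.6) p.164] -/
theorem condCov_freeCov_of_mem (hα : 0 < α) (hβ : 0 < β) (Γ : Finset (ZSite d)) {c : ZSite d} (hc : c ∈ Γ)
    (y : ZSite d) : condCov (freeCov d α β) Γ c y = 0 ∧ condCov (freeCov d α β) Γ y c = 0 :=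
  ⟨condCov_of_mem_left Γ (isUnit_det_covGram_freeCov hα hβ Γ) hc y,
    condCov_of_mem_right (freeCov_comm α β) Γ (isUnit_det_covGram_freeCov hα hβ Γ) y hc⟩

end StrictPD

/-! ## §3  The lattice equation of the conditioned covariance and a-priori bounds -/

section Conditioned

variable {α β : ℝ}

/-- kernel: the regression coefficients `a(y) = (K_ΓΓ)⁻¹K_Γ(y)` and the representation
`C^Γ(z, y) = K(z, y) − Σ_c K(z, c)·a(y)_c`. [folklore] -/
private theorem condCov_eq_sub_sum (G : ZSite d → ZSite d → ℝ) (Γ : Finset (ZSite d)) (z y : ZSite d) :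
    condCov G Γ z y = G z y - ∑ c : Γ, G z c * (∑ c' : Γ, (covGram G Γ)⁻¹ c c' * G c' y) := by
  simp only [condCov, Finset.mul_sum]
  congr 1
  exact Finset.sum_congr rfl fun c _ => Finset.sum_congr rfl fun c' _ => by ring

/-- **The lattice equation of the conditioned («Dirichelet») covariance off Γ**: for `x ∉ Γ`,
`(2d + α²)C^Γ(x, y) − Σ_μ (C^Γ(x + e_μ, y) + C^Γ(x − e_μ, y)) = β⁻¹·[x = y]` — `C^Γ(·, y)` is `K(·, y)` minus a combination of
the columns `K(·, c)`, `c ∈ Γ`, each of which solves the homogeneous equation away from `c`.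
[cite: BenfattoEtAl1978, Appendix C 2) (C.6) p.164] -/
theorem condCov_freeCov_lattice_eq (hα : 0 < α) (β : ℝ) (Γ : Finset (ZSite d)) {x : ZSite d} (hx : x ∉ Γ)
    (y : ZSite d) :
    (2 * d + α ^ 2) * condCov (freeCov d α β) Γ x y - hop (fun z => condCov (freeCov d α β) Γ z y) x =
      if x = y then β⁻¹ else 0 := by
  set a : Γ → ℝ := fun c => ∑ c' : Γ, (covGram (freeCov d α β) Γ)⁻¹ c c' * freeCov d α β c' y with ha
  have hrepr : ∀ z, condCov (freeCov d α β) Γ z y = freeCov d α β z y - ∑ c : Γ, freeCov d α β z c * a c :=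
    fun z => condCov_eq_sub_sum _ Γ z y
  simp only [hrepr]
  rw [hop_sub', hop_sum_univ' (fun (c : Γ) (z : ZSite d) => freeCov d α β z c * a c) x, mul_sub, Finset.mul_sum,
    sub_sub_sub_comm, ← Finset.sum_sub_distrib, freeCov_hop_eq β hα x y]
  have hzero : ∑ c : Γ, ((2 * d + α ^ 2) * (freeCov d α β x c * a c) - hop (fun z => freeCov d α β z c * a c) x) = 0 := by
    refine Finset.sum_eq_zero fun c _ => ?_
    have hxc : x ≠ (c : ZSite d) := fun h => hx (h ▸ c.2)
    have key := freeCov_hop_eq (d := d) β hα x c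
    rw [if_neg hxc] at key
    rw [hop_mul_const', ← mul_assoc, ← sub_mul, key, zero_mul]
  rw [hzero, sub_zero]

/-- kernel: `C^Γ(·, y)` is bounded (uniformly in the first argument). [folklore] -/
private theorem exists_bound_condCov (hα : 0 < α) (hβ : 0 < β) (Γ : Finset (ZSite d)) (y : ZSite d) :
    ∃ B : ℝ, ∀ x, |condCov (freeCov d α β) Γ x y| ≤ B := by
  set a : Γ → ℝ := fun c => ∑ c' : Γ, (covGram (freeCov d α β) Γ)⁻¹ c c' * freeCov d α β c' y with ha
  refine ⟨β⁻¹ * (α ^ 2)⁻¹ + ∑ c : Γ, β⁻¹ * (α ^ 2)⁻¹ * |a c|, fun x => ?_⟩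
  rw [condCov_eq_sub_sum _ Γ x y]
  refine (abs_sub _ _).trans (add_le_add (abs_freeCov_le hα hβ x y) ?_)
  refine (Finset.abs_sum_le_sum_abs _ _).trans (Finset.sum_le_sum fun c _ => ?_)
  rw [abs_mul]
  exact mul_le_mul_of_nonneg_right (abs_freeCov_le hα hβ x c) (abs_nonneg _)

/-- kernel: the regression mean `u = condMean K Γ z̄` is bounded. [folklore] -/
private theorem exists_bound_condMean (hα : 0 < α) (hβ : 0 < β) (Γ : Finset (ZSite d)) (zbar : ZSite d → ℝ) :
    ∃ B : ℝ, ∀ x, |condMean (freeCov d α β) Γ zbar x| ≤ B := by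
  set a : Γ → ℝ := (covGram (freeCov d α β) Γ)⁻¹ *ᵥ fun c' : Γ => zbar c' with ha
  refine ⟨∑ c : Γ, β⁻¹ * (α ^ 2)⁻¹ * |a c|, fun x => ?_⟩
  rw [condMean_eq_sum_mul, ← ha]
  refine (Finset.abs_sum_le_sum_abs _ _).trans (Finset.sum_le_sum fun c _ => ?_)
  rw [abs_mul]
  exact mul_le_mul_of_nonneg_right (abs_freeCov_le hα hβ x c) (abs_nonneg _)

/-! ## §4  The massive maximum principle on `ℤ^d ∖ Γ` (sup form, for bounded sub/solutions) -/

/-- **THE MASSIVE MAXIMUM PRINCIPLE ON `ℤ^d ∖ Γ`, sup form** (the mechanism by which the «well-known [7]» Dirichlet properties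
(C.6)–(C.8) of App. C 2) hold for the tree's regression objects; public at seat n08-b's request as the citable copy — n08-b's
`le_of_subsolution` in `…CondCentre`/`…AppendixC2` is the private `κ = m − 2d` phrasing): if `m > 2d`, `w` is bounded above, `w ≤ 0` on
`Γ` and `m·w(x) ≤ (Hw)(x)` at every `x ∉ Γ`, then `w ≤ 0` everywhere (at a point where `w` is within the factor `2d/m` of `sup w > 0`
the inequality fails; no maximiser and no finiteness of the region are needed). [cite: BenfattoEtAl1978, Appendix C 2) (C.6)–(C.8) p.164] -/
theorem le_of_hop_subsolution {m B : ℝ} (hm : (2 * d : ℝ) < m) (Γ : Finset (ZSite d)) {w : ZSite d → ℝ}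
    (hB : ∀ x, w x ≤ B) (hΓ : ∀ x ∈ Γ, w x ≤ 0) (hsub : ∀ x ∉ Γ, m * w x ≤ hop w x) : ∀ x, w x ≤ 0 := by
  have hbdd : BddAbove (Set.range w) := ⟨B, by rintro _ ⟨x, rfl⟩; exact hB x⟩
  set S : ℝ := ⨆ x, w x with hS
  have hwS : ∀ x, w x ≤ S := fun x => le_ciSup hbdd x
  have h2d : (0 : ℝ) ≤ 2 * d := by positivity
  have hm0 : 0 < m := h2d.trans_lt hm
  by_contra hcon
  push Not at hcon
  obtain ⟨x₀, hx₀⟩ := hcon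
  have hSpos : 0 < S := hx₀.trans_le (hwS x₀)
  -- a point where `w` exceeds the fraction `2d/m` of the supremum
  have hθ : 2 * d / m * S < S := by
    rw [div_mul_eq_mul_div, div_lt_iff₀ hm0]
    nlinarith
  obtain ⟨x₁, hx₁⟩ : ∃ x₁, 2 * d / m * S < w x₁ := exists_lt_of_lt_ciSup hθ
  have hx₁Γ : x₁ ∉ Γ := by
    intro h
    have h1 := hΓ x₁ h
    have h2 : 0 ≤ 2 * d / m * S := by positivity
    linarith
  have hnb : hop w x₁ ≤ 2 * d * S := by
    have : ∀ z, w z ≤ S := hwS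
    simp only [hop]
    calc ∑ μ : Fin d, (w (x₁ + unitVec μ) + w (x₁ - unitVec μ)) ≤ ∑ _μ : Fin d, (S + S) :=
          Finset.sum_le_sum fun μ _ => add_le_add (hwS _) (hwS _)
      _ = 2 * d * S := by
          rw [Finset.sum_const, Finset.card_univ, Fintype.card_fin, nsmul_eq_mul]
          ring
  have h3 := (hsub x₁ hx₁Γ).trans hnb
  have h4 : w x₁ ≤ 2 * d / m * S := by
    rw [div_mul_eq_mul_div, le_div_iff₀ hm0]
    linarith
  linarith

/-- **UNIQUENESS FOR THE MASSIVE DIRICHLET PROBLEM ON `ℤ^d ∖ Γ` AMONG BOUNDED FUNCTIONS**: `m > 2d`, `w` bounded, `w = 0` on `Γ`,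
`m·w = Hw` off `Γ` ⇒ `w ≡ 0` — whence the Markov property and (C.7) below. [cite: BenfattoEtAl1978, Appendix C 2) (C.6)–(C.8) p.164] -/
theorem eq_zero_of_hop_solution {m B : ℝ} (hm : (2 * d : ℝ) < m) (Γ : Finset (ZSite d)) {w : ZSite d → ℝ}
    (hB : ∀ x, |w x| ≤ B) (hΓ : ∀ x ∈ Γ, w x = 0) (hsol : ∀ x ∉ Γ, m * w x = hop w x) : ∀ x, w x = 0 := by
  have h1 : ∀ x, w x ≤ 0 :=
    le_of_hop_subsolution hm Γ (fun x => (le_abs_self _).trans (hB x)) (fun x hx => (hΓ x hx).le)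
      fun x hx => (hsol x hx).le
  have h2 : ∀ x, -w x ≤ 0 :=
    le_of_hop_subsolution (w := fun x => -w x) hm Γ (fun x => (neg_le_abs _).trans (hB x))
      (fun x hx => by rw [hΓ x hx, neg_zero]) fun x hx => by rw [hop_neg', ← hsol x hx]; ring_nf; exact le_rfl
  exact fun x => le_antisymm (h1 x) (by have := h2 x; linarith)

/-- **|C^Γ(x, y)| ≤ (βα²)⁻¹ uniformly** — from n08-b's (C.6) entrywise `0 ≦ C^Γ_{ΔΔ′} ≦ C_{ΔΔ′}`
(`B1Eq324BenfattoAppendixC2.condCov_freeCov_nonneg_le`) and `|K| ≤ (βα²)⁻¹`. [cite: BenfattoEtAl1978, Appendix C (C.5)–(C.6) p.164] -/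
theorem abs_condCov_freeCov_le (hα : 0 < α) (hβ : 0 < β) (Γ : Finset (ZSite d)) (x y : ZSite d) :
    |condCov (freeCov d α β) Γ x y| ≤ β⁻¹ * (α ^ 2)⁻¹ := by
  have h := condCov_freeCov_nonneg_le hα hβ Γ x y
  rw [abs_of_nonneg h.1]
  exact h.2.trans ((le_abs_self _).trans (abs_freeCov_le hα hβ x y))

end Conditioned

/-! ## §5  THE MARKOV PROPERTY of the free field ((5.13) p. 155) and the centre formula (C.7) -/

section Markov

variable {α β : ℝ}

/-- **THE MARKOV PROPERTY OF P̂₀, AT THE LEVEL OF THE CONDITIONED COVARIANCE** — §5 p. 155: *"P(dz_□̃|z_{Γ₁}) is their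
conditional probability for fixed z_{Γ₁} and the Markov property of P has been used"* (the measure conditioned on the corridors
`Γ₁` factorizes over the boxes `□̃` they enclose); App. C 2): `C^Γ` *"is the covariance with “Dirichelet boundary condition”
on Γ"*.  PROVED for the tree's regression covariance `condCov (freeCov d α β) Γ`: if a set of sites `Ω ⊆ ℤ^d ∖ Γ` is ENCLOSED by
`Γ` — every lattice neighbour of a site of `Ω` lies in `Ω ∪ Γ` — then `C^Γ(x, y) = 0` for `x ∈ Ω` and `y ∉ Ω`: conditionally on
`z_Γ` the field inside `Ω` is uncorrelated with (for a Gaussian field: independent of) the field outside.  (`Ω` need not be finite;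
`C^Γ(·, y)·1_Ω` is a bounded solution of the homogeneous lattice equation off `Γ` vanishing on `Γ`, hence `0`.)
[cite: BenfattoEtAl1978, §5 (5.13) p.155; Appendix C 2) (C.6) p.164] -/
theorem condCov_freeCov_eq_zero_of_enclosed (hα : 0 < α) (hβ : 0 < β) (Γ : Finset (ZSite d)) {Ω : Set (ZSite d)}
    (hΩΓ : ∀ z ∈ Ω, z ∉ Γ)
    (hΩ : ∀ z ∈ Ω, ∀ μ : Fin d, (z + unitVec μ ∈ Ω ∨ z + unitVec μ ∈ Γ) ∧ (z - unitVec μ ∈ Ω ∨ z - unitVec μ ∈ Γ))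
    {x y : ZSite d} (hx : x ∈ Ω) (hy : y ∉ Ω) :
    condCov (freeCov d α β) Γ x y = 0 := by
  classical
  obtain ⟨B, hB⟩ := exists_bound_condCov (d := d) hα hβ Γ y
  have hm : (2 * d : ℝ) < 2 * d + α ^ 2 := by nlinarith [pow_pos hα 2]
  set f : ZSite d → ℝ := fun z => condCov (freeCov d α β) Γ z y with hf
  set w : ZSite d → ℝ := fun z => if z ∈ Ω then f z else 0 with hw
  have hB0 : 0 ≤ B := (abs_nonneg _).trans (hB x)
  have hwB : ∀ z, |w z| ≤ B := fun z => by
    simp only [hw]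
    split_ifs
    · exact hB z
    · rw [abs_zero]
      exact hB0
  have hfΓ : ∀ z ∈ Γ, f z = 0 := fun z hz => by
    simp only [hf]
    exact (condCov_freeCov_of_mem hα hβ Γ hz y).1
  have hwΓ : ∀ z ∈ Γ, w z = 0 := fun z hz => by
    simp only [hw]
    rw [if_neg (fun hzΩ => hΩΓ z hzΩ hz)]
  -- off `Ω ∪ Γ` no lattice neighbour lies in `Ω`
  have hout : ∀ z, z ∉ Ω → z ∉ Γ → ∀ μ : Fin d, z + unitVec μ ∉ Ω ∧ z - unitVec μ ∉ Ω := by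
    intro z hzΩ hzΓ μ
    constructor
    · intro h
      rcases (hΩ _ h μ).2 with h' | h'
      · exact hzΩ (by rwa [add_sub_cancel_right] at h')
      · exact hzΓ (by rwa [add_sub_cancel_right] at h')
    · intro h
      rcases (hΩ _ h μ).1 with h' | h'
      · exact hzΩ (by rwa [sub_add_cancel] at h')
      · exact hzΓ (by rwa [sub_add_cancel] at h')
  have hsol : ∀ z ∉ Γ, (2 * d + α ^ 2) * w z = hop w z := by
    intro z hzΓ
    by_cases hzΩ : z ∈ Ω
    · -- inside `Ω`: `w = f` at `z` and at every neighbour (a neighbour in `Γ` has `w = 0 = f`)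
      have hwz : w z = f z := by simp only [hw, if_pos hzΩ]
      have hnb : ∀ z', (z' ∈ Ω ∨ z' ∈ Γ) → w z' = f z' := by
        intro z' h
        rcases h with h | h
        · simp only [hw, if_pos h]
        · rw [hwΓ z' h, hfΓ z' h]
      have hhop : hop w z = hop f z := by
        simp only [hop]
        exact Finset.sum_congr rfl fun μ _ => by rw [hnb _ (hΩ z hzΩ μ).1, hnb _ (hΩ z hzΩ μ).2]
      have key := condCov_freeCov_lattice_eq (d := d) hα β Γ hzΓ y
      have hzy : z ≠ y := fun h => hy (h ▸ hzΩ)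
      rw [if_neg hzy, sub_eq_zero] at key
      rw [hwz, hhop]
      exact key
    · have hwz : w z = 0 := by simp only [hw, if_neg hzΩ]
      have hhop : hop w z = 0 := hop_eq_zero_of_forall w z fun μ =>
        ⟨by simp only [hw, if_neg (hout z hzΩ hzΓ μ).1], by simp only [hw, if_neg (hout z hzΩ hzΓ μ).2]⟩
      rw [hwz, hhop, mul_zero]
  have h0 := eq_zero_of_hop_solution hm Γ hwB hwΓ hsol x
  simp only [hw, if_pos hx] at h0
  exact h0

/-- **The Markov property, second argument**: `C^Γ(y, x) = 0` for `x` inside and `y` outside a `Γ`-enclosed region (symmetry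
of `C^Γ`). [cite: BenfattoEtAl1978, §5 (5.13) p.155; Appendix C 2) (C.6) p.164] -/
theorem condCov_freeCov_eq_zero_of_enclosed' (hα : 0 < α) (hβ : 0 < β) (Γ : Finset (ZSite d)) {Ω : Set (ZSite d)}
    (hΩΓ : ∀ z ∈ Ω, z ∉ Γ)
    (hΩ : ∀ z ∈ Ω, ∀ μ : Fin d, (z + unitVec μ ∈ Ω ∨ z + unitVec μ ∈ Γ) ∧ (z - unitVec μ ∈ Ω ∨ z - unitVec μ ∈ Γ))
    {x y : ZSite d} (hx : x ∈ Ω) (hy : y ∉ Ω) :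
    condCov (freeCov d α β) Γ y x = 0 := by
  rw [condCov_comm (freeCov_comm α β), condCov_freeCov_eq_zero_of_enclosed hα hβ Γ hΩΓ hΩ hx hy]

/-- kernel: the boundary bookkeeping of (C.7) — `β Σ_{c∈Γ} (Σ_ν (β⁻¹[z = c + e_ν] + β⁻¹[z = c − e_ν]))·z̄_c =
Σ_ν (z̄·1_Γ)(z + e_ν) + (z̄·1_Γ)(z − e_ν) = H(z̄·1_Γ)(z)`. [folklore] -/
private theorem sum_boundary_ite (Γ : Finset (ZSite d)) (zbar : ZSite d → ℝ) (hβ : β ≠ 0) (z : ZSite d) :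
    β * ∑ c ∈ Γ, (∑ ν : Fin d, ((if z = c + unitVec ν then β⁻¹ else 0) + (if z = c - unitVec ν then β⁻¹ else 0))) * zbar c
      = hop (fun z' => if z' ∈ Γ then zbar z' else 0) z := by
  classical
  have hterm : ∀ c ∈ Γ, β * ((∑ ν : Fin d, ((if z = c + unitVec ν then β⁻¹ else 0) + (if z = c - unitVec ν then β⁻¹ else 0)))
      * zbar c) = ∑ ν : Fin d, ((if c = z - unitVec ν then zbar c else 0) + (if c = z + unitVec ν then zbar c else 0)) := by
    intro c _
    rw [Finset.sum_mul, Finset.mul_sum]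
    refine Finset.sum_congr rfl fun ν _ => ?_
    have h1 : (z = c + unitVec ν) ↔ (c = z - unitVec ν) := by
      rw [eq_sub_iff_add_eq]
      exact eq_comm
    have h2 : (z = c - unitVec ν) ↔ (c = z + unitVec ν) := by
      rw [← sub_eq_iff_eq_add]
      exact eq_comm
    rw [add_mul, mul_add]
    congr 1
    · by_cases ha : z = c + unitVec ν
      · rw [if_pos ha, if_pos (h1.mp ha)]
        field_simp
      · rw [if_neg ha, if_neg (fun h => ha (h1.mpr h)), zero_mul, mul_zero]
    · by_cases hb : z = c - unitVec ν
      · rw [if_pos hb, if_pos (h2.mp hb)]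
        field_simp
      · rw [if_neg hb, if_neg (fun h => hb (h2.mpr h)), zero_mul, mul_zero]
  rw [Finset.mul_sum, Finset.sum_congr rfl hterm, Finset.sum_comm]
  simp only [hop, Finset.sum_add_distrib, Finset.sum_ite_eq', add_comm]

/-- **(C.7) AS AN IDENTITY — THE CENTRE OF THE CONDITIONED FIELD THROUGH THE DIRICHLET COVARIANCE**: p. 164, *"center
u_Δ = β Σ_{Δ′⊂Γ} (Σ_{Δ″⊄Γ, Δ″ n.n. to Δ′} C^Γ_{ΔΔ″}) z_{Δ′} (C.7)"* — PROVED for the tree's regression mean and covariance: for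
every `x ∉ Γ`, `u(x) = β Σ_{c∈Γ} (Σ_μ (C^Γ(x, c + e_μ) + C^Γ(x, c − e_μ)))·z̄_c` (the neighbours `c ± e_μ` that lie IN `Γ`
contribute `C^Γ(x, ·) = 0` by §2, which is print's restriction «Δ″ ⊄ Γ»).  Proof: both sides, corrected by the boundary datum
`z̄·1_Γ`, are bounded solutions of `(2d + α²)w = Hw` off `Γ` with the same source `H(z̄·1_Γ)` and vanish on `Γ`; uniqueness (§4).
[cite: BenfattoEtAl1978, Appendix C 2) (C.7) p.164] -/
theorem condMean_freeCov_eq_boundary_sum (hα : 0 < α) (hβ : 0 < β) (Γ : Finset (ZSite d)) (zbar : ZSite d → ℝ)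
    {x : ZSite d} (hx : x ∉ Γ) :
    condMean (freeCov d α β) Γ zbar x = β * ∑ c ∈ Γ, hop (condCov (freeCov d α β) Γ x) c * zbar c := by
  classical
  have hm : (2 * d : ℝ) < 2 * d + α ^ 2 := by nlinarith [pow_pos hα 2]
  set u : ZSite d → ℝ := condMean (freeCov d α β) Γ zbar with hu
  set R : ZSite d → ℝ := fun z => β * ∑ c ∈ Γ, hop (condCov (freeCov d α β) Γ z) c * zbar c with hR
  set zΓ : ZSite d → ℝ := fun z => if z ∈ Γ then zbar z else 0 with hzΓ
  set w : ZSite d → ℝ := fun z => (u z - zΓ z) - R z with hw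
  -- (i) `w` is bounded
  obtain ⟨Bu, hBu⟩ := exists_bound_condMean (d := d) hα hβ Γ zbar
  have hCb : ∀ z y', |condCov (freeCov d α β) Γ z y'| ≤ β⁻¹ * (α ^ 2)⁻¹ := abs_condCov_freeCov_le hα hβ Γ
  have hRb : ∀ z, |R z| ≤ |β| * ∑ c ∈ Γ, 2 * d * (β⁻¹ * (α ^ 2)⁻¹) * |zbar c| := by
    intro z
    simp only [hR]
    rw [abs_mul]
    refine mul_le_mul_of_nonneg_left ?_ (abs_nonneg β)
    refine (Finset.abs_sum_le_sum_abs _ _).trans (Finset.sum_le_sum fun c _ => ?_)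
    rw [abs_mul]
    exact mul_le_mul_of_nonneg_right (abs_hop_le' (fun y' => hCb z y') c) (abs_nonneg _)
  have hzb : ∀ z, |zΓ z| ≤ ∑ c ∈ Γ, |zbar c| := by
    intro z
    simp only [hzΓ]
    split_ifs with h
    · exact Finset.single_le_sum (f := fun c => |zbar c|) (fun c _ => abs_nonneg _) h
    · rw [abs_zero]
      exact Finset.sum_nonneg fun c _ => abs_nonneg _
  have hwB : ∀ z, |w z| ≤ Bu + ∑ c ∈ Γ, |zbar c| + |β| * ∑ c ∈ Γ, 2 * d * (β⁻¹ * (α ^ 2)⁻¹) * |zbar c| := by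
    intro z
    simp only [hw]
    exact (abs_sub _ _).trans (add_le_add ((abs_sub _ _).trans (add_le_add (hBu z) (hzb z))) (hRb z))
  -- (ii) `w` vanishes on `Γ`: `u = z̄` there and `R(c) = 0` since `C^Γ(c, ·) ≡ 0`
  have hRΓ : ∀ c ∈ Γ, R c = 0 := by
    intro c hc
    simp only [hR]
    rw [Finset.sum_eq_zero, mul_zero]
    intro c' _
    rw [hop_eq_zero_of_forall, zero_mul]
    exact fun μ => ⟨(condCov_freeCov_of_mem hα hβ Γ hc _).1, (condCov_freeCov_of_mem hα hβ Γ hc _).1⟩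
  have hwΓ : ∀ z ∈ Γ, w z = 0 := fun z hz => by
    simp only [hw, hzΓ, if_pos hz, hRΓ z hz, hu, condMean_freeCov_apply_of_mem hα hβ Γ zbar hz, sub_self]
  -- (iii) the lattice operator of `R` off `Γ` is `H(z̄·1_Γ)`
  have hLC : ∀ z ∉ Γ, ∀ y' : ZSite d, (2 * d + α ^ 2) * condCov (freeCov d α β) Γ z y'
      - hop (fun z' => condCov (freeCov d α β) Γ z' y') z = if z = y' then β⁻¹ else 0 :=
    fun z hz y' => condCov_freeCov_lattice_eq hα β Γ hz y'
  have hLφ : ∀ z ∉ Γ, ∀ c : ZSite d, (2 * d + α ^ 2) * hop (condCov (freeCov d α β) Γ z) c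
      - hop (fun z' => hop (condCov (freeCov d α β) Γ z') c) z
        = ∑ ν : Fin d, ((if z = c + unitVec ν then β⁻¹ else 0) + (if z = c - unitVec ν then β⁻¹ else 0)) := by
    intro z hz c
    have hφ : ∀ z', hop (condCov (freeCov d α β) Γ z') c = ∑ ν : Fin d,
        (condCov (freeCov d α β) Γ z' (c + unitVec ν) + condCov (freeCov d α β) Γ z' (c - unitVec ν)) := fun z' => rfl
    simp only [hφ]
    rw [hop_sum_univ' (fun ν z' => condCov (freeCov d α β) Γ z' (c + unitVec ν)
      + condCov (freeCov d α β) Γ z' (c - unitVec ν)) z, Finset.mul_sum, ← Finset.sum_sub_distrib]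
    refine Finset.sum_congr rfl fun ν _ => ?_
    rw [hop_add', ← hLC z hz (c + unitVec ν), ← hLC z hz (c - unitVec ν)]
    ring
  have hLR : ∀ z ∉ Γ, (2 * d + α ^ 2) * R z - hop R z = hop zΓ z := by
    intro z hz
    have hR' : ∀ z', R z' = β * ∑ c ∈ Γ, hop (condCov (freeCov d α β) Γ z') c * zbar c := fun z' => rfl
    simp only [hR']
    rw [hop_const_mul', mul_left_comm, ← mul_sub,
      hop_finset_sum' Γ (fun c z' => hop (condCov (freeCov d α β) Γ z') c * zbar c) z, Finset.mul_sum,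
      ← Finset.sum_sub_distrib]
    have hc : ∀ c ∈ Γ, (2 * d + α ^ 2) * (hop (condCov (freeCov d α β) Γ z) c * zbar c)
        - hop (fun z' => hop (condCov (freeCov d α β) Γ z') c * zbar c) z
        = (∑ ν : Fin d, ((if z = c + unitVec ν then β⁻¹ else 0) + (if z = c - unitVec ν then β⁻¹ else 0))) * zbar c := by
      intro c _
      rw [hop_mul_const', ← mul_assoc, ← sub_mul, hLφ z hz c]
    rw [Finset.sum_congr rfl hc, hzΓ]
    exact sum_boundary_ite Γ zbar hβ.ne' z
  -- (iv) the equation for `w` off `Γ`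
  have hsol : ∀ z ∉ Γ, (2 * d + α ^ 2) * w z = hop w z := by
    intro z hz
    have hw' : ∀ z', w z' = (u z' - zΓ z') - R z' := fun z' => rfl
    rw [hw']
    rw [hop_sub' (fun z' => u z' - zΓ z') R z, hop_sub' u zΓ z]
    have hharm : (2 * d + α ^ 2) * u z = hop u z := condMean_freeCov_harmonic β hα Γ zbar hz
    have hzz : zΓ z = 0 := by simp only [hzΓ, if_neg hz]
    have hR' := hLR z hz
    rw [hzz]
    linear_combination hharm - hR'
  have h0 := eq_zero_of_hop_solution hm Γ hwB hwΓ hsol x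
  have hzx : zΓ x = 0 := by simp only [hzΓ, if_neg hx]
  have hw' : w x = (u x - zΓ x) - R x := rfl
  rw [hw', hzx, sub_zero, sub_eq_zero] at h0
  exact h0

/-- **LOCALITY OF THE CENTRE (the structure of (C.7))**: for a `Γ`-enclosed region `Ω` and `x ∈ Ω`, the conditional centre
`u(x)` depends on the conditioning data `z̄` only through the sites of `Γ` ADJACENT to `Ω` — in (C.7) the inner sum runs over
`Δ″ ∉ Γ` n.n. to `Δ′`, and `C^Γ_{ΔΔ″} = 0` unless `Δ″` lies in `Δ`'s enclosure (Markov property).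
[cite: BenfattoEtAl1978, Appendix C 2) (C.7) p.164; §5 (5.13) p.155] -/
theorem condMean_freeCov_congr_of_enclosed (hα : 0 < α) (hβ : 0 < β) (Γ : Finset (ZSite d)) {Ω : Set (ZSite d)}
    (hΩΓ : ∀ z ∈ Ω, z ∉ Γ)
    (hΩ : ∀ z ∈ Ω, ∀ μ : Fin d, (z + unitVec μ ∈ Ω ∨ z + unitVec μ ∈ Γ) ∧ (z - unitVec μ ∈ Ω ∨ z - unitVec μ ∈ Γ))
    {zbar zbar' : ZSite d → ℝ}
    (h : ∀ c ∈ Γ, (∃ μ : Fin d, c + unitVec μ ∈ Ω ∨ c - unitVec μ ∈ Ω) → zbar c = zbar' c) {x : ZSite d} (hx : x ∈ Ω) :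
    condMean (freeCov d α β) Γ zbar x = condMean (freeCov d α β) Γ zbar' x := by
  have hxΓ : x ∉ Γ := hΩΓ x hx
  rw [condMean_freeCov_eq_boundary_sum hα hβ Γ zbar hxΓ, condMean_freeCov_eq_boundary_sum hα hβ Γ zbar' hxΓ]
  congr 1
  refine Finset.sum_congr rfl fun c hc => ?_
  by_cases hadj : ∃ μ : Fin d, c + unitVec μ ∈ Ω ∨ c - unitVec μ ∈ Ω
  · rw [h c hc hadj]
  · push Not at hadj
    rw [hop_eq_zero_of_forall _ _ fun μ => ⟨condCov_freeCov_eq_zero_of_enclosed hα hβ Γ hΩΓ hΩ hx (hadj μ).1,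
      condCov_freeCov_eq_zero_of_enclosed hα hβ Γ hΩΓ hΩ hx (hadj μ).2⟩, zero_mul, zero_mul]

end Markov

/-! ## §6  The conditioned field `P̄ = condField d α β Γ z̄` as a measure: Gaussian with centre `u` and covariance `C^Γ`;
the Markov property as INDEPENDENCE under `P̄` -/

section Field

open _root_.MeasureTheory _root_.ProbabilityTheory

variable {α β : ℝ}

/-- kernel: the shift `ζ ↦ u + ζ` by a fixed configuration is measurable. [folklore] -/
private theorem measurable_shift (u : ZSite d → ℝ) :
    Measurable fun (ζ : ZSite d → ℝ) (x : ZSite d) => u x + ζ x :=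
  measurable_pi_lambda _ fun x => measurable_const.add (measurable_pi_apply x)

/-- **P̄ is a probability measure** (`α, β > 0`; the Schur-complement kernel is positive semidefinite by n08-b's
`isPosSemidefKernel_condCov_freeCov`). [cite: BenfattoEtAl1978, p.152 «the conditional distribution P̂₀(dz|(z̄_Δ)_{Δ∈C})»] -/
theorem isProbabilityMeasure_condField (hα : 0 < α) (hβ : 0 < β) (Γ : Finset (ZSite d)) (zbar : ZSite d → ℝ) :
    IsProbabilityMeasure (condField d α β Γ zbar) := by
  haveI := isProbabilityMeasure_gaussianFieldOfKernel (isPosSemidefKernel_condCov_freeCov (d := d) hα hβ Γ)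
  rw [show condField d α β Γ zbar = (gaussianFieldOfKernel (condCov (freeCov d α β) Γ)).map
      (fun (ζ : ZSite d → ℝ) (x : ZSite d) => condMean (freeCov d α β) Γ zbar x + ζ x) from rfl]
  exact Measure.isProbabilityMeasure_map (measurable_shift _).aemeasurable

/-- **Under P̄ the coordinates form a (non-centred) GAUSSIAN FIELD** — p. 164: *"the conditioned variables (z_Δ)_{Δ∉Γ} are a
non centered gaussian field"* (every finite-dimensional marginal of `P̄` is the corresponding marginal of the centred field of
`C^Γ` translated by `u|_I`). [cite: BenfattoEtAl1978, Appendix C 2) p.164] -/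
theorem isGaussianProcess_condField (hα : 0 < α) (hβ : 0 < β) (Γ : Finset (ZSite d)) (zbar : ZSite d → ℝ) :
    IsGaussianProcess (fun (x : ZSite d) (z : ZSite d → ℝ) => z x) (condField d α β Γ zbar) := by
  classical
  have hKc := isPosSemidefKernel_condCov_freeCov (d := d) hα hβ Γ
  set Q := gaussianFieldOfKernel (condCov (freeCov d α β) Γ) with hQ
  haveI := isProbabilityMeasure_gaussianFieldOfKernel hKc
  set u : ZSite d → ℝ := condMean (freeCov d α β) Γ zbar with hu
  set T : (ZSite d → ℝ) → (ZSite d → ℝ) := fun ζ x => u x + ζ x with hT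
  have hTm : Measurable T := measurable_shift u
  rw [show condField d α β Γ zbar = Q.map T from rfl]
  refine ⟨fun I => ?_⟩
  have hG : HasGaussianLaw (fun ζ : ZSite d → ℝ => I.restrict ζ) Q :=
    (isGaussianProcess_eval_gaussianFieldOfKernel hKc).hasGaussianLaw I
  have hrm : Measurable (fun z : ZSite d → ℝ => I.restrict z) := Finset.measurable_restrict I
  have hcomp : (fun z : ZSite d → ℝ => I.restrict z) ∘ T = (fun v : I → ℝ => I.restrict u + v) ∘ fun ζ => I.restrict ζ := by
    funext ζ
    ext i
    simp only [Function.comp_apply, Finset.restrict, hT, Pi.add_apply]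
  have hshift : Measurable fun v : I → ℝ => I.restrict u + v := measurable_const.add measurable_id
  refine ⟨?_⟩
  rw [Measure.map_map hrm hTm]
  change IsGaussian (Q.map ((fun z : ZSite d → ℝ => I.restrict z) ∘ T))
  rw [hcomp, ← Measure.map_map hshift hrm]
  haveI : IsGaussian (Q.map fun ζ : ZSite d → ℝ => I.restrict ζ) := hG.isGaussian_map
  infer_instance

/-- **The centre of P̄ is the regression mean `u`**: `∫ z_x dP̄ = u(x) = condMean (freeCov d α β) Γ z̄ x` — p. 164 «center u_Δ».
[cite: BenfattoEtAl1978, Appendix C 2) (C.7) p.164] -/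
theorem integral_eval_condField (hα : 0 < α) (hβ : 0 < β) (Γ : Finset (ZSite d)) (zbar : ZSite d → ℝ) (x : ZSite d) :
    ∫ z, z x ∂condField d α β Γ zbar = condMean (freeCov d α β) Γ zbar x := by
  have hKc := isPosSemidefKernel_condCov_freeCov (d := d) hα hβ Γ
  set Q := gaussianFieldOfKernel (condCov (freeCov d α β) Γ) with hQ
  haveI := isProbabilityMeasure_gaussianFieldOfKernel hKc
  set u : ZSite d → ℝ := condMean (freeCov d α β) Γ zbar with hu
  set T : (ZSite d → ℝ) → (ZSite d → ℝ) := fun ζ x => u x + ζ x with hT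
  have hTm : Measurable T := measurable_shift u
  rw [show condField d α β Γ zbar = Q.map T from rfl,
    integral_map hTm.aemeasurable (measurable_pi_apply x).aestronglyMeasurable]
  have hint : Integrable (fun ζ : ZSite d → ℝ => ζ x) Q :=
    ((isGaussianProcess_eval_gaussianFieldOfKernel hKc).hasGaussianLaw_eval x).integrable
  change ∫ ζ, (u x + ζ x) ∂Q = u x
  rw [integral_add (integrable_const _) hint, integral_const, integral_eval_gaussianFieldOfKernel hKc x, add_zero,
    probReal_univ, one_smul]

/-- **The covariance of P̄ is the Dirichlet covariance `C^Γ`**: `Cov_P̄(z_x, z_y) = condCov (freeCov d α β) Γ x y` — p. 164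
«with covariance C^Γ_{ΔΔ′}». [cite: BenfattoEtAl1978, Appendix C 2) (C.6) p.164] -/
theorem covariance_eval_condField (hα : 0 < α) (hβ : 0 < β) (Γ : Finset (ZSite d)) (zbar : ZSite d → ℝ) (x y : ZSite d) :
    cov[fun z => z x, fun z => z y; condField d α β Γ zbar] = condCov (freeCov d α β) Γ x y := by
  have hKc := isPosSemidefKernel_condCov_freeCov (d := d) hα hβ Γ
  set Q := gaussianFieldOfKernel (condCov (freeCov d α β) Γ) with hQ
  haveI := isProbabilityMeasure_gaussianFieldOfKernel hKc
  set u : ZSite d → ℝ := condMean (freeCov d α β) Γ zbar with hu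
  set T : (ZSite d → ℝ) → (ZSite d → ℝ) := fun ζ x => u x + ζ x with hT
  have hTm : Measurable T := measurable_shift u
  rw [show condField d α β Γ zbar = Q.map T from rfl,
    covariance_map (measurable_pi_apply x).aestronglyMeasurable (measurable_pi_apply y).aestronglyMeasurable hTm.aemeasurable]
  have hix : Integrable (fun ζ : ZSite d → ℝ => ζ x) Q :=
    ((isGaussianProcess_eval_gaussianFieldOfKernel hKc).hasGaussianLaw_eval x).integrable
  have hiy : Integrable (fun ζ : ZSite d → ℝ => ζ y) Q :=
    ((isGaussianProcess_eval_gaussianFieldOfKernel hKc).hasGaussianLaw_eval y).integrable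
  change cov[fun ζ => u x + ζ x, fun ζ => u y + ζ y; Q] = _
  rw [covariance_const_add_left hix, covariance_const_add_right hiy, covariance_eval_gaussianFieldOfKernel hKc x y]

/-- **THE MARKOV PROPERTY AS INDEPENDENCE UNDER P̄** — (5.13) p. 155: the measure conditioned on `z_Γ` factorizes over the
regions `Γ` encloses: for a `Γ`-enclosed `Ω ⊆ ℤ^d ∖ Γ`, under `P̄ = condField d α β Γ z̄` the family of coordinates `(z_x)_{x∈Ω}` is
INDEPENDENT of the family `(z_y)_{y∉Ω}` (jointly Gaussian with vanishing cross-covariances, `condCov_freeCov_eq_zero_of_enclosed` +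
Mathlib's `IsGaussianProcess.indepFun_of_covariance_eq_zero`). [cite: BenfattoEtAl1978, §5 (5.13) p.155] -/
theorem indepFun_condField_of_enclosed (hα : 0 < α) (hβ : 0 < β) (Γ : Finset (ZSite d)) {Ω : Set (ZSite d)}
    (hΩΓ : ∀ z ∈ Ω, z ∉ Γ)
    (hΩ : ∀ z ∈ Ω, ∀ μ : Fin d, (z + unitVec μ ∈ Ω ∨ z + unitVec μ ∈ Γ) ∧ (z - unitVec μ ∈ Ω ∨ z - unitVec μ ∈ Γ))
    (zbar : ZSite d → ℝ) :
    IndepFun (fun (z : ZSite d → ℝ) (s : Ω) => z s) (fun (z : ZSite d → ℝ) (t : ↥Ωᶜ) => z t) (condField d α β Γ zbar) := by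
  have hG := isGaussianProcess_condField hα hβ Γ zbar
  have hXY : IsGaussianProcess (Sum.elim (fun (s : Ω) (z : ZSite d → ℝ) => z s) (fun (t : ↥Ωᶜ) (z : ZSite d → ℝ) => z t))
      (condField d α β Γ zbar) := by
    have h := hG.comp_right (Sum.elim (fun s : Ω => (s : ZSite d)) (fun t : ↥Ωᶜ => (t : ZSite d)))
    have he : (fun (x : ZSite d) (z : ZSite d → ℝ) => z x) ∘ Sum.elim (fun s : Ω => (s : ZSite d)) (fun t : ↥Ωᶜ => (t : ZSite d))
        = Sum.elim (fun (s : Ω) (z : ZSite d → ℝ) => z s) (fun (t : ↥Ωᶜ) (z : ZSite d → ℝ) => z t) := by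
      funext i
      cases i <;> rfl
    rwa [he] at h
  refine hXY.indepFun_of_covariance_eq_zero (fun s => (measurable_pi_apply _).aemeasurable)
    (fun t => (measurable_pi_apply _).aemeasurable) fun s t => ?_
  rw [covariance_eval_condField hα hβ Γ zbar]
  exact condCov_freeCov_eq_zero_of_enclosed hα hβ Γ hΩΓ hΩ s.2 t.2

/-- **(5.13)'s FACTORISATION OVER SEVERAL ENCLOSED REGIONS — mutual independence under P̄**: for a family of pairwise disjoint
`Γ`-enclosed regions `Ω_i ⊆ ℤ^d ∖ Γ` (print: the boxes `□̃ ∖ Γ₁` separated by the corridors `Γ₁`), under `P̄ = condField d α β Γ z̄`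
the coordinate families `((z_x)_{x∈Ω_i})_i` are MUTUALLY INDEPENDENT — «the measure P, conditioned to the fixed values z̄ will then
factorize “over the boxes □”» (p. 153), «the Markov property of P has been used» (p. 155).  (Jointly Gaussian with vanishing
cross-covariances by the Markov property; Mathlib's `IsGaussianProcess.iIndepFun_of_covariance_eq_zero`.)
[cite: BenfattoEtAl1978, §5 (5.13) p.155; p.153] -/
theorem iIndepFun_condField_of_enclosed (hα : 0 < α) (hβ : 0 < β) (Γ : Finset (ZSite d)) {ι : Type*}
    {Ω : ι → Set (ZSite d)} (hΩΓ : ∀ i, ∀ z ∈ Ω i, z ∉ Γ)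
    (hΩ : ∀ i, ∀ z ∈ Ω i, ∀ μ : Fin d,
      (z + unitVec μ ∈ Ω i ∨ z + unitVec μ ∈ Γ) ∧ (z - unitVec μ ∈ Ω i ∨ z - unitVec μ ∈ Γ))
    (hdisj : ∀ i j, i ≠ j → Disjoint (Ω i) (Ω j)) (zbar : ZSite d → ℝ) :
    iIndepFun (fun i (z : ZSite d → ℝ) (s : Ω i) => z s) (condField d α β Γ zbar) := by
  have hG := isGaussianProcess_condField hα hβ Γ zbar
  have hX : IsGaussianProcess (fun (p : (i : ι) × Ω i) (z : ZSite d → ℝ) => z (p.2 : ZSite d)) (condField d α β Γ zbar) :=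
    hG.comp_right (fun p : (i : ι) × Ω i => (p.2 : ZSite d))
  refine IsGaussianProcess.iIndepFun_of_covariance_eq_zero (X := fun i (s : Ω i) (z : ZSite d → ℝ) => z s) hX
    (fun i s => (measurable_pi_apply _).aemeasurable) fun i j hij s t => ?_
  rw [covariance_eval_condField hα hβ Γ zbar]
  exact condCov_freeCov_eq_zero_of_enclosed hα hβ Γ (hΩΓ i) (hΩ i) s.2
    (fun ht => Set.disjoint_left.mp (hdisj i j hij) ht t.2)

end Field



end Literature.MathematicalPhysics.QuantumFieldTheory.Balaban1983to89.B1Eq324BenfattoMarkov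

end
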